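import Mathlib.MeasureTheory.Function.L2Space
import Mathlib.MeasureTheory.Function.LpSpace.Indicator
import Mathlib.MeasureTheory.Function.LocallyIntegrable
import Mathlib.MeasureTheory.Integral.Prod
import Mathlib.MeasureTheory.Integral.Bochner.ContinuousLinearMap
import Mathlib.MeasureTheory.Measure.Lebesgue.Basic
import Mathlib.Analysis.InnerProductSpace.Adjoint
import Literature.Analysis.OperatorTheory.IntegralOperatorHilbertSchmidt
import HarnessLib

/-!
# Integral operators on `L²(ℝ)` with continuous compactly supported kernels

Topic `Literature/Analysis/OperatorTheory`. Definitions with bodies and theorems (no named fact).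

For a kernel `K : ℝ → ℝ → ℂ` which is jointly continuous with compact support (`NiceKernel K`)
the integral operator `(T_K u)(ξ) = ∫ K(ξ, x) u(x) dx` is a bounded operator on the Hilbert space
`L²(ℝ) = Lp ℂ 2 volume` (`kernelOp`), and everything about it is classical Fubini:

* `kernelOp_coeFn` — `T_K u = ∫ K(·, x) u(x) dx` a.e.; `inner_kernelOp_left` —
  `⟪T_K u, v⟫ = ∫ conj(∫ K(ξ,x)u(x)dx) v(ξ) dξ`;
* `adjoint_kernelOp` — **the adjoint is the integral operator with kernel `conj K(ξ, x)`
  transposed** (`adjointKernel`);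
* `inner_kernelOp_kernelOp` — `⟪T_{K₁} u, T_{K₂} v⟫ = ∫∫ conj u(x) v(y) N(x,y) dx dy` with
  `N(x, y) = ∫ conj K₁(ξ, x) K₂(ξ, y) dξ` (the kernel of `T_{K₁}^* T_{K₂}`), and the resulting
  bound `‖T_{K₂}^* T_{K₁}‖`-type estimate `norm_inner_kernelOp_kernelOp_le` from a sup bound on `N`
  and the lengths of the `x`-supports (Cauchy–Schwarz on an interval,
  `setIntegral_norm_le_sqrt_mul_norm`);
* `opNorm_le_of_inner_le` — `‖T‖ ≤ C` from `|⟪T u, v⟫| ≤ C ‖u‖ ‖v‖` (any Hilbert space).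

Written for the almost-orthogonality argument (Cotlar–Stein, `CotlarStein.lean`) in the proof of
[DyatlovJinNonnenmacher2021, Prop. 2.9], Steps 3–5, whose operators `A_{jk} = χ_j^- 𝓕_h χ_k^+`
have the continuous compactly supported kernels `(2πh)^{-1/2} χ_j^-(ξ) e^{-ixξ/h} χ_k^+(x)`.
All statements are folklore.

## References

* [DyatlovJinNonnenmacher2021] S. Dyatlov, L. Jin, S. Nonnenmacher, J. Amer. Math. Soc. 35 (2022)
  = arXiv:1906.08923, §2.4, proof of Prop. 2.9, Steps 3–5 (the kernels `𝒦(x, y)` of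
  `A_{jk}A_{j'k'}^*`).
-/

noncomputable section

open MeasureTheory Set Function
open scoped ComplexConjugate InnerProductSpace ENNReal

namespace Literature.Analysis.OperatorTheory

/-! ## Nice kernels -/

/-- A kernel `K : ℝ → ℝ → ℂ` which is jointly continuous with compact support. [folklore] -/
structure NiceKernel (K : ℝ → ℝ → ℂ) : Prop where
  continuous : Continuous (uncurry K)
  hasCompactSupport : HasCompactSupport (uncurry K)

namespace NiceKernel

variable {K : ℝ → ℝ → ℂ}

/-- A continuous compactly supported kernel is bounded. [folklore] -/
theorem exists_bound (hK : NiceKernel K) : ∃ M : ℝ, 0 ≤ M ∧ ∀ ξ x, ‖K ξ x‖ ≤ M := by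
  obtain ⟨C, hC⟩ := hK.continuous.bounded_above_of_compact_support hK.hasCompactSupport
  exact ⟨max C 0, le_max_right _ _, fun ξ x => (hC (ξ, x)).trans (le_max_left _ _)⟩

/-- A bound `M ≥ 0` for `|K|`. [folklore] -/
def bound (hK : NiceKernel K) : ℝ := Classical.choose hK.exists_bound

/-- `0 ≤ M`. [folklore] -/
theorem bound_nonneg (hK : NiceKernel K) : 0 ≤ hK.bound := (Classical.choose_spec hK.exists_bound).1

/-- `|K(ξ, x)| ≤ M`. [folklore] -/
theorem norm_le (hK : NiceKernel K) (ξ x : ℝ) : ‖K ξ x‖ ≤ hK.bound :=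
  (Classical.choose_spec hK.exists_bound).2 ξ x

/-- The support of a nice kernel lies in a square `[-R, R]²`. [folklore] -/
theorem exists_radius (hK : NiceKernel K) :
    ∃ R : ℝ, 0 < R ∧ ∀ ξ x, K ξ x ≠ 0 → ξ ∈ Icc (-R) R ∧ x ∈ Icc (-R) R := by
  obtain ⟨r, hr⟩ := hK.hasCompactSupport.isCompact.isBounded.subset_closedBall (0 : ℝ × ℝ)
  refine ⟨max r 1, by positivity, fun ξ x hne => ?_⟩
  have hmem : (ξ, x) ∈ Metric.closedBall (0 : ℝ × ℝ) r :=
    hr (subset_tsupport _ (Function.mem_support.2 (by simpa using hne)))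
  rw [Metric.mem_closedBall, dist_zero_right, Prod.norm_def, Real.norm_eq_abs,
    Real.norm_eq_abs] at hmem
  have h1 : |ξ| ≤ max r 1 := ((le_max_left _ _).trans hmem).trans (le_max_left _ _)
  have h2 : |x| ≤ max r 1 := ((le_max_right _ _).trans hmem).trans (le_max_left _ _)
  exact ⟨⟨(abs_le.1 h1).1, (abs_le.1 h1).2⟩, ⟨(abs_le.1 h2).1, (abs_le.1 h2).2⟩⟩

/-- A radius `R > 0` with `K(ξ, x) = 0` unless `|ξ|, |x| ≤ R`. [folklore] -/
def radius (hK : NiceKernel K) : ℝ := Classical.choose hK.exists_radius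

/-- `0 < R`. [folklore] -/
theorem radius_pos (hK : NiceKernel K) : 0 < hK.radius := (Classical.choose_spec hK.exists_radius).1

/-- The box side `S = [-R, R]`. [folklore] -/
def box (hK : NiceKernel K) : Set ℝ := Icc (-hK.radius) hK.radius

/-- The box side is compact. [folklore] -/
theorem isCompact_box (hK : NiceKernel K) : IsCompact hK.box := isCompact_Icc

/-- The box side is measurable. [folklore] -/
theorem measurableSet_box (hK : NiceKernel K) : MeasurableSet hK.box := measurableSet_Icc

/-- The box side has finite measure. [folklore] -/
theorem volume_box_lt_top (hK : NiceKernel K) : volume hK.box < ∞ := measure_Icc_lt_top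

/-- `K(ξ, x) ≠ 0 ⟹ ξ, x ∈ [-R, R]`. [folklore] -/
theorem mem_box_of_ne_zero (hK : NiceKernel K) {ξ x : ℝ} (h : K ξ x ≠ 0) :
    ξ ∈ hK.box ∧ x ∈ hK.box :=
  (Classical.choose_spec hK.exists_radius).2 ξ x h

/-- `K(ξ, x) = 0` for `ξ ∉ [-R, R]`. [folklore] -/
theorem eq_zero_of_left_notMem (hK : NiceKernel K) {ξ : ℝ} (hξ : ξ ∉ hK.box) (x : ℝ) : K ξ x = 0 := by
  by_contra h; exact hξ (hK.mem_box_of_ne_zero h).1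

/-- `K(ξ, x) = 0` for `x ∉ [-R, R]`. [folklore] -/
theorem eq_zero_of_right_notMem (hK : NiceKernel K) (ξ : ℝ) {x : ℝ} (hx : x ∉ hK.box) : K ξ x = 0 := by
  by_contra h; exact hx (hK.mem_box_of_ne_zero h).2

/-- `K(ξ, ·)` is continuous. [folklore] -/
theorem continuous_left (hK : NiceKernel K) (ξ : ℝ) : Continuous (K ξ) :=
  hK.continuous.comp (Continuous.prodMk_right ξ)

/-- `K(·, x)` is continuous. [folklore] -/
theorem continuous_right (hK : NiceKernel K) (x : ℝ) : Continuous fun ξ => K ξ x :=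
  hK.continuous.comp (Continuous.prodMk_left x)

/-- The kernel `K†(x, ξ) = conj K(ξ, x)` of the adjoint. [folklore] -/
def _root_.Literature.Analysis.OperatorTheory.adjointKernel (K : ℝ → ℝ → ℂ) (x ξ : ℝ) : ℂ :=
  conj (K ξ x)

/-- The adjoint kernel of a nice kernel is nice. [folklore] -/
theorem adjoint (hK : NiceKernel K) : NiceKernel (adjointKernel K) where
  continuous := by
    have : uncurry (adjointKernel K) = (fun z => conj z) ∘ uncurry K ∘ Prod.swap := by
      ext p; rfl
    rw [this]
    exact Complex.continuous_conj.comp (hK.continuous.comp continuous_swap)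
  hasCompactSupport := by
    have : uncurry (adjointKernel K) = (fun z => conj z) ∘ (uncurry K ∘ Prod.swap) := by
      ext p; rfl
    rw [this]
    refine HasCompactSupport.comp_left ?_ (map_zero _)
    exact hK.hasCompactSupport.comp_homeomorph (Homeomorph.prodComm ℝ ℝ)

end NiceKernel

/-! ## The action on functions -/

/-- `(T_K u)(ξ) = ∫ K(ξ, x) u(x) dx`. [folklore] -/
def kernelFun (K : ℝ → ℝ → ℂ) (u : ℝ → ℂ) (ξ : ℝ) : ℂ := ∫ x, K ξ x * u x

section Action

variable {K : ℝ → ℝ → ℂ} (hK : NiceKernel K) {u : ℝ → ℂ}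

/-- `L²` functions are integrable on the box. [folklore] -/
theorem integrableOn_box_of_memLp (hK : NiceKernel K) (hu : MemLp u 2 volume) :
    IntegrableOn u hK.box volume :=
  (hu.locallyIntegrable one_le_two).integrableOn_isCompact hK.isCompact_box

include hK in
/-- The integrand `x ↦ K(ξ, x) u(x)` is integrable for `u ∈ L²`. [folklore] -/
theorem integrable_kernel_mul (hu : MemLp u 2 volume) (ξ : ℝ) :
    Integrable (fun x => K ξ x * u x) volume := by
  have heq : (fun x => K ξ x * u x) = hK.box.indicator (fun x => K ξ x * u x) := by
    ext x
    by_cases hx : x ∈ hK.box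
    · rw [indicator_of_mem hx]
    · rw [indicator_of_notMem hx, hK.eq_zero_of_right_notMem ξ hx, zero_mul]
  rw [heq, integrable_indicator_iff hK.measurableSet_box]
  exact (integrableOn_box_of_memLp hK hu).bdd_mul (c := hK.bound)
    (hK.continuous_left ξ).aestronglyMeasurable (Filter.Eventually.of_forall fun x => hK.norm_le ξ x)

include hK in
/-- `|(T_K u)(ξ)| ≤ M ∫_S |u|`. [folklore] -/
theorem norm_kernelFun_le (hu : MemLp u 2 volume) (ξ : ℝ) :
    ‖kernelFun K u ξ‖ ≤ hK.bound * ∫ x in hK.box, ‖u x‖ := by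
  unfold kernelFun
  have heq : ∫ x, K ξ x * u x = ∫ x in hK.box, K ξ x * u x :=
    (setIntegral_eq_integral_of_forall_compl_eq_zero fun x hx => by
      rw [hK.eq_zero_of_right_notMem ξ hx, zero_mul]).symm
  rw [heq]
  calc ‖∫ x in hK.box, K ξ x * u x‖ ≤ ∫ x in hK.box, ‖K ξ x * u x‖ := norm_integral_le_integral_norm _
    _ ≤ ∫ x in hK.box, hK.bound * ‖u x‖ := by
        refine integral_mono_of_nonneg (Filter.Eventually.of_forall fun _ => norm_nonneg _)
          ((integrableOn_box_of_memLp hK hu).norm.const_mul _)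
          (Filter.Eventually.of_forall fun x => ?_)
        show ‖K ξ x * u x‖ ≤ hK.bound * ‖u x‖
        rw [norm_mul]
        exact mul_le_mul_of_nonneg_right (hK.norm_le ξ x) (norm_nonneg _)
    _ = hK.bound * ∫ x in hK.box, ‖u x‖ := integral_const_mul _ _

include hK in
/-- `(T_K u)(ξ) = 0` for `ξ ∉ [-R, R]`. [folklore] -/
theorem kernelFun_eq_zero (u : ℝ → ℂ) {ξ : ℝ} (hξ : ξ ∉ hK.box) : kernelFun K u ξ = 0 := by
  unfold kernelFun
  simp [hK.eq_zero_of_left_notMem hξ]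

include hK in
/-- `T_K u` is continuous (dominated convergence). [folklore] -/
theorem continuous_kernelFun (hu : MemLp u 2 volume) : Continuous (kernelFun K u) := by
  unfold kernelFun
  refine continuous_of_dominated (bound := fun x => hK.bound * ‖hK.box.indicator u x‖)
    (fun ξ => (integrable_kernel_mul hK hu ξ).aestronglyMeasurable) (fun ξ => ?_) ?_ ?_
  · refine Filter.Eventually.of_forall fun x => ?_
    by_cases hx : x ∈ hK.box
    · rw [indicator_of_mem hx, norm_mul]
      exact mul_le_mul_of_nonneg_right (hK.norm_le ξ x) (norm_nonneg _)
    · rw [hK.eq_zero_of_right_notMem ξ hx, zero_mul, norm_zero]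
      exact mul_nonneg hK.bound_nonneg (norm_nonneg _)
  · exact ((integrableOn_box_of_memLp hK hu).integrable_indicator hK.measurableSet_box).norm.const_mul _
  · exact Filter.Eventually.of_forall fun x => (hK.continuous_right x).mul continuous_const

include hK in
/-- `T_K u` has compact support. [folklore] -/
theorem hasCompactSupport_kernelFun (u : ℝ → ℂ) : HasCompactSupport (kernelFun K u) :=
  HasCompactSupport.of_support_subset_isCompact hK.isCompact_box fun ξ hξ => by
    by_contra h; exact (Function.mem_support.1 hξ) (kernelFun_eq_zero hK u h)

include hK in
/-- `T_K u ∈ L²`. [folklore] -/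
theorem memLp_kernelFun (hu : MemLp u 2 volume) : MemLp (kernelFun K u) 2 volume :=
  (continuous_kernelFun hK hu).memLp_of_hasCompactSupport (hasCompactSupport_kernelFun hK u)

/-- `kernelFun` only depends on the a.e. class of `u`. [folklore] -/
theorem kernelFun_congr_ae {u v : ℝ → ℂ} (h : u =ᵐ[volume] v) : kernelFun K u = kernelFun K v := by
  ext ξ
  refine integral_congr_ae ?_
  filter_upwards [h] with x hx
  rw [hx]

include hK in
/-- `T_K (u + v) = T_K u + T_K v` pointwise for `u, v ∈ L²`. [folklore] -/
theorem kernelFun_add {u v : ℝ → ℂ} (hu : MemLp u 2 volume) (hv : MemLp v 2 volume) :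
    kernelFun K (u + v) = kernelFun K u + kernelFun K v := by
  ext ξ
  simp only [kernelFun, Pi.add_apply, mul_add]
  exact integral_add (integrable_kernel_mul hK hu ξ) (integrable_kernel_mul hK hv ξ)

/-- `T_K (c u) = c T_K u` pointwise. [folklore] -/
theorem kernelFun_smul (c : ℂ) (u : ℝ → ℂ) : kernelFun K (c • u) = c • kernelFun K u := by
  ext ξ
  simp only [kernelFun, Pi.smul_apply, smul_eq_mul]
  rw [← integral_const_mul]
  congr 1; ext x; ring

end Action

/-! ## Cauchy–Schwarz on an interval -/

/-- `‖u‖²_{L²} = ∫ |u|²` for `u ∈ L²(ℝ)`. [folklore] -/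
theorem norm_Lp_sq_eq_integral (u : Lp ℂ 2 (volume : Measure ℝ)) : ‖u‖ ^ 2 = ∫ x, ‖u x‖ ^ 2 := by
  conv_lhs => rw [← Lp.toLp_coeFn u (Lp.memLp u)]
  exact norm_toLp_sq_eq_integral_norm_sq (Lp.memLp u)

/-- `∫_s |u| ≤ √(vol s) ‖u‖_{L²}`. [folklore] -/
theorem setIntegral_norm_le_sqrt_mul_norm (u : Lp ℂ 2 (volume : Measure ℝ)) {s : Set ℝ}
    (hs : MeasurableSet s) (hμs : volume s ≠ ∞) :
    ∫ x in s, ‖u x‖ ≤ Real.sqrt (volume.real s) * ‖u‖ := by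
  -- `g = |u| ∈ L²(ℝ; ℝ)` with `‖g‖ = ‖u‖`, and `∫_s |u| = ⟪𝟙_s, g⟫ ≤ ‖𝟙_s‖ ‖g‖`
  have hg : MemLp (fun x => ‖u x‖) 2 volume := (Lp.memLp u).norm
  set g : Lp ℝ 2 (volume : Measure ℝ) := hg.toLp _ with hgdef
  have hnorm : ‖g‖ = ‖u‖ := by
    rw [hgdef, Lp.norm_toLp, Lp.norm_def, eLpNorm_norm]
  have hinner : (⟪indicatorConstLp 2 hs hμs (1 : ℝ), g⟫_ℝ) = ∫ x in s, ‖u x‖ := by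
    rw [L2.inner_indicatorConstLp_one]
    refine integral_congr_ae (ae_restrict_of_ae ?_)
    exact hg.coeFn_toLp
  rw [← hinner, ← hnorm]
  refine (real_inner_le_norm _ _).trans (le_of_eq ?_)
  rw [norm_indicatorConstLp two_ne_zero ENNReal.ofNat_ne_top, norm_one, one_mul,
    Real.sqrt_eq_rpow]
  norm_num

/-! ## The operator on `L²(ℝ)` -/

section Operator

variable {K : ℝ → ℝ → ℂ}

/-- The linear map `u ↦ T_K u` on `L²(ℝ)`. [folklore] -/
def kernelOpLin (hK : NiceKernel K) : Lp ℂ 2 (volume : Measure ℝ) →ₗ[ℂ] Lp ℂ 2 (volume : Measure ℝ) where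
  toFun u := (memLp_kernelFun hK (Lp.memLp u)).toLp (kernelFun K u)
  map_add' u v := by
    rw [← MemLp.toLp_add (memLp_kernelFun hK (Lp.memLp u)) (memLp_kernelFun hK (Lp.memLp v))]
    refine MemLp.toLp_congr _ _ (Filter.EventuallyEq.of_eq ?_)
    rw [kernelFun_congr_ae (Lp.coeFn_add u v)]
    exact kernelFun_add hK (Lp.memLp u) (Lp.memLp v)
  map_smul' c u := by
    rw [RingHom.id_apply, ← MemLp.toLp_const_smul c (memLp_kernelFun hK (Lp.memLp u))]
    refine MemLp.toLp_congr _ _ (Filter.EventuallyEq.of_eq ?_)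
    rw [kernelFun_congr_ae (Lp.coeFn_smul c u)]
    exact kernelFun_smul c _

/-- Unfolding `kernelOpLin`. [folklore] -/
theorem kernelOpLin_apply (hK : NiceKernel K) (u : Lp ℂ 2 (volume : Measure ℝ)) :
    kernelOpLin hK u = (memLp_kernelFun hK (Lp.memLp u)).toLp (kernelFun K u) := rfl

/-- The operator norm bound `‖T_K u‖ ≤ 2R M ‖u‖`. [folklore] -/
theorem norm_kernelOpLin_le (hK : NiceKernel K) (u : Lp ℂ 2 (volume : Measure ℝ)) :
    ‖kernelOpLin hK u‖ ≤ 2 * hK.radius * hK.bound * ‖u‖ := by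
  have hR := hK.radius_pos
  have hM0 := hK.bound_nonneg
  have hvol : volume.real hK.box = 2 * hK.radius := by
    rw [NiceKernel.box, Real.volume_real_Icc_of_le (by linarith)]; ring
  -- pointwise bound `|T_K u(ξ)| ≤ M √(2R) ‖u‖` on the box, `0` outside
  have hpt : ∀ ξ, ‖kernelFun K u ξ‖ ≤ hK.bound * (Real.sqrt (2 * hK.radius) * ‖u‖) := by
    intro ξ
    refine (norm_kernelFun_le hK (Lp.memLp u) ξ).trans (mul_le_mul_of_nonneg_left ?_ hK.bound_nonneg)
    have h := setIntegral_norm_le_sqrt_mul_norm u hK.measurableSet_box hK.volume_box_lt_top.ne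
    rwa [hvol] at h
  set C : ℝ := hK.bound * (Real.sqrt (2 * hK.radius) * ‖u‖) with hC
  have hC0 : 0 ≤ C := by positivity
  -- integrate the square over the box
  have hsq : ‖kernelOpLin hK u‖ ^ 2 ≤ (2 * hK.radius * hK.bound * ‖u‖) ^ 2 := by
    rw [kernelOpLin_apply, norm_toLp_sq_eq_integral_norm_sq]
    have hzero : ∀ ξ, ξ ∉ hK.box → ‖kernelFun K u ξ‖ ^ 2 = 0 := fun ξ hξ => by
      rw [kernelFun_eq_zero hK _ hξ, norm_zero]; ring
    rw [← setIntegral_eq_integral_of_forall_compl_eq_zero (s := hK.box) (fun ξ hξ => hzero ξ hξ)]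
    calc ∫ ξ in hK.box, ‖kernelFun K u ξ‖ ^ 2 ≤ ∫ _ξ in hK.box, C ^ 2 := by
          refine setIntegral_mono_on ?_ (integrableOn_const hK.volume_box_lt_top.ne)
            hK.measurableSet_box fun ξ _ => ?_
          · exact ((memLp_two_iff_integrable_sq_norm
              (memLp_kernelFun hK (Lp.memLp u)).aestronglyMeasurable).1
              (memLp_kernelFun hK (Lp.memLp u))).integrableOn
          · exact pow_le_pow_left₀ (norm_nonneg _) (hpt ξ) 2
      _ = 2 * hK.radius * C ^ 2 := by rw [setIntegral_const, smul_eq_mul, hvol]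
      _ = (2 * hK.radius * hK.bound * ‖u‖) ^ 2 := by
          rw [hC, mul_pow, mul_pow, Real.sq_sqrt (by positivity)]; ring
  exact le_of_pow_le_pow_left₀ two_ne_zero (by positivity) hsq

/-- **The integral operator `T_K` on `L²(ℝ)`** for a continuous compactly supported kernel. [folklore] -/
def kernelOp (hK : NiceKernel K) : Lp ℂ 2 (volume : Measure ℝ) →L[ℂ] Lp ℂ 2 (volume : Measure ℝ) :=
  (kernelOpLin hK).mkContinuous (2 * hK.radius * hK.bound) (norm_kernelOpLin_le hK)

/-- Unfolding `kernelOp`. [folklore] -/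
theorem kernelOp_apply (hK : NiceKernel K) (u : Lp ℂ 2 (volume : Measure ℝ)) :
    kernelOp hK u = (memLp_kernelFun hK (Lp.memLp u)).toLp (kernelFun K u) := rfl

/-- `T_K u = ∫ K(·, x) u(x) dx` almost everywhere. [folklore] -/
theorem kernelOp_coeFn (hK : NiceKernel K) (u : Lp ℂ 2 (volume : Measure ℝ)) :
    ⇑(kernelOp hK u) =ᵐ[volume] kernelFun K u := by
  rw [kernelOp_apply]; exact MemLp.coeFn_toLp _

/-- `‖T_K u‖² = ∫ |∫ K(ξ,x) u(x) dx|² dξ`. [folklore] -/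
theorem norm_kernelOp_sq (hK : NiceKernel K) (u : Lp ℂ 2 (volume : Measure ℝ)) :
    ‖kernelOp hK u‖ ^ 2 = ∫ ξ, ‖kernelFun K u ξ‖ ^ 2 := by
  rw [kernelOp_apply, norm_toLp_sq_eq_integral_norm_sq]

/-- `⟪T_K u, v⟫ = ∫ conj((T_K u)(ξ)) v(ξ) dξ`. [folklore] -/
theorem inner_kernelOp_left (hK : NiceKernel K) (u v : Lp ℂ 2 (volume : Measure ℝ)) :
    ⟪kernelOp hK u, v⟫_ℂ = ∫ ξ, conj (kernelFun K u ξ) * v ξ := by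
  rw [L2.inner_def]
  refine integral_congr_ae ?_
  filter_upwards [kernelOp_coeFn hK u] with ξ hξ
  rw [hξ, RCLike.inner_apply']

/-- `⟪v, T_K u⟫ = ∫ conj v(ξ) (T_K u)(ξ) dξ`. [folklore] -/
theorem inner_kernelOp_right (hK : NiceKernel K) (u v : Lp ℂ 2 (volume : Measure ℝ)) :
    ⟪v, kernelOp hK u⟫_ℂ = ∫ ξ, conj (v ξ) * kernelFun K u ξ := by
  rw [L2.inner_def]
  refine integral_congr_ae ?_
  filter_upwards [kernelOp_coeFn hK u] with ξ hξ
  rw [hξ, RCLike.inner_apply']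

/-- `⟪T_{K₁} u, T_{K₂} v⟫ = ∫ conj((T_{K₁} u)(ξ)) (T_{K₂} v)(ξ) dξ`. [folklore] -/
theorem inner_kernelOp_kernelOp_eq_integral {K₁ K₂ : ℝ → ℝ → ℂ} (h₁ : NiceKernel K₁) (h₂ : NiceKernel K₂)
    (u v : Lp ℂ 2 (volume : Measure ℝ)) :
    ⟪kernelOp h₁ u, kernelOp h₂ v⟫_ℂ = ∫ ξ, conj (kernelFun K₁ u ξ) * kernelFun K₂ v ξ := by
  rw [L2.inner_def]
  refine integral_congr_ae ?_
  filter_upwards [kernelOp_coeFn h₁ u, kernelOp_coeFn h₂ v] with ξ h1 h2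
  rw [h1, h2, RCLike.inner_apply']

end Operator

/-! ## Fubini: the adjoint and the kernel of `T_{K₁}^* T_{K₂}` -/

section Fubini

variable {K : ℝ → ℝ → ℂ}

/-- Integrability on `ℝ × ℝ` of `(ξ, x) ↦ K(ξ,x) a(ξ) b(x)` for `a, b ∈ L²`. [folklore] -/
theorem integrable_kernel_mul_mul (hK : NiceKernel K) {a b : ℝ → ℂ} (ha : MemLp a 2 volume)
    (hb : MemLp b 2 volume) :
    Integrable (fun p : ℝ × ℝ => K p.1 p.2 * a p.1 * b p.2) (volume.prod volume) := by
  have hA : Integrable (hK.box.indicator a) volume :=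
    (integrableOn_box_of_memLp hK ha).integrable_indicator hK.measurableSet_box
  have hB : Integrable (hK.box.indicator b) volume :=
    (integrableOn_box_of_memLp hK hb).integrable_indicator hK.measurableSet_box
  have hprod : Integrable (fun p : ℝ × ℝ =>
      hK.bound * (‖hK.box.indicator a p.1‖ * ‖hK.box.indicator b p.2‖)) (volume.prod volume) :=
    (hA.norm.mul_prod hB.norm).const_mul _
  refine hprod.mono' ?_ (Filter.Eventually.of_forall fun p => ?_)
  · exact ((hK.continuous.aestronglyMeasurable.mul ha.aestronglyMeasurable.comp_fst).mul
      hb.aestronglyMeasurable.comp_snd)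
  · rcases p with ⟨ξ, x⟩
    show ‖K ξ x * a ξ * b x‖ ≤ hK.bound * (‖hK.box.indicator a ξ‖ * ‖hK.box.indicator b x‖)
    by_cases hξ : ξ ∈ hK.box
    · by_cases hx : x ∈ hK.box
      · rw [indicator_of_mem hξ, indicator_of_mem hx, norm_mul, norm_mul, mul_assoc]
        exact mul_le_mul_of_nonneg_right (hK.norm_le ξ x) (by positivity)
      · rw [hK.eq_zero_of_right_notMem ξ hx]
        simp only [zero_mul, norm_zero]
        exact mul_nonneg hK.bound_nonneg (by positivity)
    · rw [hK.eq_zero_of_left_notMem hξ]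
      simp only [zero_mul, norm_zero]
      exact mul_nonneg hK.bound_nonneg (by positivity)

/-- **The adjoint of `T_K` is `T_{K†}`**, `K†(x, ξ) = conj K(ξ, x)`. [folklore] -/
theorem adjoint_kernelOp (hK : NiceKernel K) :
    ContinuousLinearMap.adjoint (kernelOp hK) = kernelOp hK.adjoint := by
  symm
  rw [ContinuousLinearMap.eq_adjoint_iff]
  intro v u
  -- `⟪T_{K†} v, u⟫ = ∫_x conj(∫_ξ conj K(ξ,x) v(ξ)) u(x) = ∫_x ∫_ξ K(ξ,x) conj v(ξ) u(x)`
  rw [inner_kernelOp_left, inner_kernelOp_right]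
  have hL : ∀ x, conj (kernelFun (adjointKernel K) v x) * u x = ∫ ξ, K ξ x * conj (v ξ) * u x := by
    intro x
    rw [kernelFun, ← integral_conj, ← integral_mul_const]
    congr 1; ext ξ
    simp only [adjointKernel, map_mul, Complex.conj_conj]
  have hR : ∀ ξ, conj (v ξ) * kernelFun K u ξ = ∫ x, K ξ x * conj (v ξ) * u x := by
    intro ξ
    rw [kernelFun, ← integral_const_mul]
    congr 1; ext x; ring
  simp_rw [hL, hR]
  -- Fubini
  have hint := integrable_kernel_mul_mul hK ((Lp.memLp v).star) (Lp.memLp u)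
  exact (integral_integral_swap hint).symm

/-- The kernel `N(x, y) = ∫ conj K₁(ξ, x) K₂(ξ, y) dξ` of `T_{K₁}^* T_{K₂}`. [folklore] -/
def grammKernel (K₁ K₂ : ℝ → ℝ → ℂ) (x y : ℝ) : ℂ := ∫ ξ, conj (K₁ ξ x) * K₂ ξ y

/-- **`⟪T_{K₁} u, T_{K₂} v⟫ = ∫∫ conj u(x) v(y) N(x, y) dy dx`** (Fubini). [folklore] -/
theorem inner_kernelOp_kernelOp {K₁ K₂ : ℝ → ℝ → ℂ} (h₁ : NiceKernel K₁) (h₂ : NiceKernel K₂)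
    (u v : Lp ℂ 2 (volume : Measure ℝ)) :
    ⟪kernelOp h₁ u, kernelOp h₂ v⟫_ℂ =
      ∫ x, ∫ y, conj (u x) * v y * grammKernel K₁ K₂ x y := by
  rw [inner_kernelOp_kernelOp_eq_integral]
  -- the triple integrand
  set F : ℝ → ℝ × ℝ → ℂ := fun ξ p => (conj (K₁ ξ p.1) * conj (u p.1)) * (K₂ ξ p.2 * v p.2) with hF
  -- Step 1: for each `ξ`, the product of the two integrals is a double integral
  have h1 : ∀ ξ, conj (kernelFun K₁ u ξ) * kernelFun K₂ v ξ =
      ∫ p : ℝ × ℝ, F ξ p ∂(volume.prod volume) := by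
    intro ξ
    rw [kernelFun, kernelFun, ← integral_conj, ← integral_prod_mul]
    simp only [hF, map_mul]
  simp_rw [h1]
  -- Step 2: integrability of `(ξ, p) ↦ F ξ p` on `ℝ × (ℝ × ℝ)`
  have hu := Lp.memLp u
  have hv := Lp.memLp v
  have hA : Integrable (h₁.box.indicator (fun x => conj (u x))) volume :=
    (integrableOn_box_of_memLp h₁ hu.star).integrable_indicator h₁.measurableSet_box
  have hB : Integrable (h₂.box.indicator v) volume :=
    (integrableOn_box_of_memLp h₂ hv).integrable_indicator h₂.measurableSet_box
  have hC : Integrable (h₁.box.indicator fun _ : ℝ => (h₁.bound * h₂.bound : ℝ)) volume :=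
    (integrableOn_const h₁.volume_box_lt_top.ne).integrable_indicator h₁.measurableSet_box
  have hdom : Integrable (fun q : ℝ × (ℝ × ℝ) =>
      h₁.box.indicator (fun _ : ℝ => (h₁.bound * h₂.bound : ℝ)) q.1 *
        (‖h₁.box.indicator (fun x => conj (u x)) q.2.1‖ * ‖h₂.box.indicator v q.2.2‖))
      (volume.prod (volume.prod volume)) := hC.mul_prod (hA.norm.mul_prod hB.norm)
  have hmeas : AEStronglyMeasurable (uncurry F) (volume.prod (volume.prod volume)) := by
    simp only [hF]
    apply AEStronglyMeasurable.mul
    · apply AEStronglyMeasurable.mul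
      · -- `conj K₁(ξ, x)` as a function of `(ξ, (x, y))`
        have hc : Continuous fun q : ℝ × (ℝ × ℝ) => conj (K₁ q.1 q.2.1) :=
          Complex.continuous_conj.comp (h₁.continuous.comp (continuous_fst.prodMk
            (continuous_fst.comp continuous_snd)))
        exact hc.aestronglyMeasurable
      · exact (hu.star.aestronglyMeasurable.comp_fst).comp_snd
    · apply AEStronglyMeasurable.mul
      · have hc : Continuous fun q : ℝ × (ℝ × ℝ) => K₂ q.1 q.2.2 :=
          h₂.continuous.comp (continuous_fst.prodMk (continuous_snd.comp continuous_snd))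
        exact hc.aestronglyMeasurable
      · exact (hv.aestronglyMeasurable.comp_snd).comp_snd
  have hM₁ := h₁.bound_nonneg
  have hM₂ := h₂.bound_nonneg
  have hint : Integrable (uncurry F) (volume.prod (volume.prod volume)) := by
    refine hdom.mono' hmeas (Filter.Eventually.of_forall fun q => ?_)
    rcases q with ⟨ξ, x, y⟩
    show ‖(conj (K₁ ξ x) * conj (u x)) * (K₂ ξ y * v y)‖ ≤
      h₁.box.indicator (fun _ : ℝ => (h₁.bound * h₂.bound : ℝ)) ξ *
        (‖h₁.box.indicator (fun x => conj (u x)) x‖ * ‖h₂.box.indicator v y‖)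
    by_cases hξ : ξ ∈ h₁.box
    · by_cases hx : x ∈ h₁.box
      · by_cases hy : y ∈ h₂.box
        · rw [indicator_of_mem hξ, indicator_of_mem hx, indicator_of_mem hy]
          simp only [norm_mul, Complex.norm_conj]
          have e1 := h₁.norm_le ξ x
          have e2 := h₂.norm_le ξ y
          have : ‖K₁ ξ x‖ * ‖K₂ ξ y‖ ≤ h₁.bound * h₂.bound :=
            mul_le_mul e1 e2 (norm_nonneg _) h₁.bound_nonneg
          calc ‖K₁ ξ x‖ * ‖(u : ℝ → ℂ) x‖ * (‖K₂ ξ y‖ * ‖(v : ℝ → ℂ) y‖)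
              = (‖K₁ ξ x‖ * ‖K₂ ξ y‖) * (‖(u : ℝ → ℂ) x‖ * ‖(v : ℝ → ℂ) y‖) := by ring
            _ ≤ (h₁.bound * h₂.bound) * (‖(u : ℝ → ℂ) x‖ * ‖(v : ℝ → ℂ) y‖) :=
              mul_le_mul_of_nonneg_right this (by positivity)
        · rw [h₂.eq_zero_of_right_notMem ξ hy]
          simp only [zero_mul, mul_zero, norm_zero]
          exact mul_nonneg (Set.indicator_nonneg (fun _ _ => by positivity) _) (by positivity)
      · rw [h₁.eq_zero_of_right_notMem ξ hx]
        simp only [map_zero, zero_mul, norm_zero]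
        exact mul_nonneg (Set.indicator_nonneg (fun _ _ => by positivity) _) (by positivity)
    · rw [h₁.eq_zero_of_left_notMem hξ]
      simp only [map_zero, zero_mul, norm_zero]
      exact mul_nonneg (Set.indicator_nonneg (fun _ _ => by positivity) _) (by positivity)
  -- Step 3: swap `ξ` with `p = (x, y)` and split `p`
  rw [integral_integral_swap hint]
  have h2 : Integrable (fun p : ℝ × ℝ => ∫ ξ, F ξ p) (volume.prod volume) :=
    hint.integral_prod_right
  rw [integral_prod _ h2]
  refine integral_congr_ae (Filter.Eventually.of_forall fun x => ?_)
  refine integral_congr_ae (Filter.Eventually.of_forall fun y => ?_)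
  simp only [hF, grammKernel]
  rw [← integral_const_mul]
  congr 1; ext ξ; ring

/-- `N(x, y) = 0` unless `x` is in the box of `K₁` (and `y` in that of `K₂`). [folklore] -/
theorem grammKernel_eq_zero_left {K₁ K₂ : ℝ → ℝ → ℂ} (h₁ : NiceKernel K₁) {x : ℝ} (hx : x ∉ h₁.box)
    (y : ℝ) : grammKernel K₁ K₂ x y = 0 := by
  simp [grammKernel, h₁.eq_zero_of_right_notMem _ hx]

/-- `N(x, y) = 0` unless `y` is in the box of `K₂`. [folklore] -/
theorem grammKernel_eq_zero_right {K₁ K₂ : ℝ → ℝ → ℂ} (h₂ : NiceKernel K₂) (x : ℝ) {y : ℝ}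
    (hy : y ∉ h₂.box) : grammKernel K₁ K₂ x y = 0 := by
  simp [grammKernel, h₂.eq_zero_of_right_notMem _ hy]

/-- `L²` functions are integrable on compact intervals. [folklore] -/
theorem integrableOn_Icc_of_memLp {u : ℝ → ℂ} (hu : MemLp u 2 volume) (a b : ℝ) :
    IntegrableOn u (Icc a b) volume :=
  (hu.locallyIntegrable one_le_two).integrableOn_isCompact isCompact_Icc

/-- **Schur-type bound from a sup bound on the kernel of `T_{K₁}^* T_{K₂}`:** if `|N(x, y)| ≤ D`
for `x ∈ [a₁, b₁] ⊇ x`-support of `K₁` and `y ∈ [a₂, b₂] ⊇ y`-support of `K₂`, then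
`|⟪T_{K₁} u, T_{K₂} v⟫| ≤ D √(b₁ - a₁) √(b₂ - a₂) ‖u‖ ‖v‖` (Cauchy–Schwarz on the two
intervals). [folklore] -/
theorem norm_inner_kernelOp_kernelOp_le {K₁ K₂ : ℝ → ℝ → ℂ} (h₁ : NiceKernel K₁) (h₂ : NiceKernel K₂)
    {a₁ b₁ a₂ b₂ : ℝ} (hab₁ : a₁ ≤ b₁) (hab₂ : a₂ ≤ b₂)
    (hK₁ : ∀ ξ x, K₁ ξ x ≠ 0 → x ∈ Icc a₁ b₁) (hK₂ : ∀ ξ y, K₂ ξ y ≠ 0 → y ∈ Icc a₂ b₂)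
    {D : ℝ} (hD0 : 0 ≤ D) (hD : ∀ x ∈ Icc a₁ b₁, ∀ y ∈ Icc a₂ b₂, ‖grammKernel K₁ K₂ x y‖ ≤ D)
    (u v : Lp ℂ 2 (volume : Measure ℝ)) :
    ‖⟪kernelOp h₁ u, kernelOp h₂ v⟫_ℂ‖ ≤
      D * Real.sqrt (b₁ - a₁) * Real.sqrt (b₂ - a₂) * ‖u‖ * ‖v‖ := by
  rw [inner_kernelOp_kernelOp]
  have hN1 : ∀ x, x ∉ Icc a₁ b₁ → ∀ y, grammKernel K₁ K₂ x y = 0 := fun x hx y => by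
    have : ∀ ξ, K₁ ξ x = 0 := fun ξ => by by_contra h; exact hx (hK₁ ξ x h)
    simp [grammKernel, this]
  have hN2 : ∀ y, y ∉ Icc a₂ b₂ → ∀ x, grammKernel K₁ K₂ x y = 0 := fun y hy x => by
    have : ∀ ξ, K₂ ξ y = 0 := fun ξ => by by_contra h; exact hy (hK₂ ξ y h)
    simp [grammKernel, this]
  have hu := Lp.memLp u
  have hv := Lp.memLp v
  set Iv : ℝ := ∫ y in Icc a₂ b₂, ‖v y‖ with hIv
  have hIv0 : 0 ≤ Iv := integral_nonneg fun _ => norm_nonneg _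
  have hIvle : Iv ≤ Real.sqrt (b₂ - a₂) * ‖v‖ := by
    have h := setIntegral_norm_le_sqrt_mul_norm v (measurableSet_Icc (a := a₂) (b := b₂))
      measure_Icc_lt_top.ne
    rwa [Real.volume_real_Icc_of_le hab₂] at h
  have hIule : ∫ x in Icc a₁ b₁, ‖u x‖ ≤ Real.sqrt (b₁ - a₁) * ‖u‖ := by
    have h := setIntegral_norm_le_sqrt_mul_norm u (measurableSet_Icc (a := a₁) (b := b₁))
      measure_Icc_lt_top.ne
    rwa [Real.volume_real_Icc_of_le hab₁] at h
  -- the inner integral, pointwise in `x`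
  have hinner : ∀ x, ‖∫ y, conj (u x) * v y * grammKernel K₁ K₂ x y‖ ≤
      D * Iv * ‖(Icc a₁ b₁).indicator (u : ℝ → ℂ) x‖ := by
    intro x
    by_cases hx : x ∈ Icc a₁ b₁
    · rw [indicator_of_mem hx]
      calc ‖∫ y, conj (u x) * v y * grammKernel K₁ K₂ x y‖
          ≤ ∫ y, ‖conj (u x) * v y * grammKernel K₁ K₂ x y‖ := norm_integral_le_integral_norm _
        _ = ∫ y in Icc a₂ b₂, ‖conj (u x) * v y * grammKernel K₁ K₂ x y‖ :=
            (setIntegral_eq_integral_of_forall_compl_eq_zero fun y hy => by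
              rw [hN2 y hy x, mul_zero, norm_zero]).symm
        _ ≤ ∫ y in Icc a₂ b₂, D * ‖u x‖ * ‖v y‖ := by
            refine integral_mono_of_nonneg (Filter.Eventually.of_forall fun _ => norm_nonneg _)
              ((integrableOn_Icc_of_memLp hv a₂ b₂).norm.const_mul _) ?_
            rw [Filter.EventuallyLE, ae_restrict_iff' measurableSet_Icc]
            refine Filter.Eventually.of_forall fun y hy => ?_
            rw [norm_mul, norm_mul, Complex.norm_conj]
            calc ‖u x‖ * ‖v y‖ * ‖grammKernel K₁ K₂ x y‖ ≤ ‖u x‖ * ‖v y‖ * D :=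
                  mul_le_mul_of_nonneg_left (hD x hx y hy) (by positivity)
              _ = D * ‖u x‖ * ‖v y‖ := by ring
        _ = D * Iv * ‖u x‖ := by rw [integral_const_mul, hIv]; ring
    · have h0 : ∀ y, conj (u x) * v y * grammKernel K₁ K₂ x y = 0 := fun y => by
        rw [hN1 x hx y, mul_zero]
      simp only [h0, integral_zero, norm_zero, indicator_of_notMem hx, mul_zero, le_refl]
  -- integrate in `x`
  have hind : Integrable (fun x => ‖(Icc a₁ b₁).indicator (u : ℝ → ℂ) x‖) volume :=
    ((integrableOn_Icc_of_memLp hu a₁ b₁).integrable_indicator measurableSet_Icc).norm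
  calc ‖∫ x, ∫ y, conj (u x) * v y * grammKernel K₁ K₂ x y‖
      ≤ ∫ x, ‖∫ y, conj (u x) * v y * grammKernel K₁ K₂ x y‖ := norm_integral_le_integral_norm _
    _ ≤ ∫ x, D * Iv * ‖(Icc a₁ b₁).indicator (u : ℝ → ℂ) x‖ :=
        integral_mono_of_nonneg (Filter.Eventually.of_forall fun _ => norm_nonneg _)
          (hind.const_mul _) (Filter.Eventually.of_forall hinner)
    _ = D * Iv * ∫ x in Icc a₁ b₁, ‖u x‖ := by
        rw [integral_const_mul]
        congr 1
        rw [← integral_indicator measurableSet_Icc]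
        congr 1; ext x
        rw [norm_indicator_eq_indicator_norm]
    _ ≤ D * (Real.sqrt (b₂ - a₂) * ‖v‖) * (Real.sqrt (b₁ - a₁) * ‖u‖) := by
        gcongr
    _ = D * Real.sqrt (b₁ - a₁) * Real.sqrt (b₂ - a₂) * ‖u‖ * ‖v‖ := by ring

end Fubini

/-! ## Operator norms from bilinear bounds -/

/-- In a Hilbert space, `|⟪T u, v⟫| ≤ C ‖u‖ ‖v‖` for all `u, v` gives `‖T‖ ≤ C`. [folklore] -/
theorem opNorm_le_of_inner_le {E : Type*} [NormedAddCommGroup E] [InnerProductSpace ℂ E]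
    (T : E →L[ℂ] E) {C : ℝ} (hC : 0 ≤ C) (h : ∀ u v, ‖⟪T u, v⟫_ℂ‖ ≤ C * ‖u‖ * ‖v‖) : ‖T‖ ≤ C := by
  refine ContinuousLinearMap.opNorm_le_bound _ hC fun u => ?_
  have h1 : ‖T u‖ ^ 2 ≤ C * ‖u‖ * ‖T u‖ := by
    have := h u (T u)
    rwa [inner_self_eq_norm_sq_to_K, norm_pow, RCLike.norm_ofReal, abs_norm] at this
  by_cases hTu : ‖T u‖ = 0
  · rw [hTu]; positivity
  · have hpos : 0 < ‖T u‖ := lt_of_le_of_ne (norm_nonneg _) (Ne.symm hTu)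
    rw [sq] at h1
    exact le_of_mul_le_mul_right h1 hpos

end Literature.Analysis.OperatorTheory
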